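import Summits.AtomisticToContinuum.Crystallization.Theorems.FrustratedLawDichotomyStrainedPatchPairTubeA
import Summits.AtomisticToContinuum.Crystallization.Theorems.FrustratedLawDichotomyAperiodicGapRecordJunctionCore

/-!
(PRE-SPLIT FOR THE 400-LINE CAP, lens-5 g84: this file = part 2 of 2 (§3 junction + crux by name, §4 the pair bridge (D_GB) and the cover cut, §5 cell shapes);
it imports part 1 `…FrustratedLawDichotomyStrainedPatchPairTubeA` (lands first); same namespace.)
# Strained patch · «PairTube» (decomp-a2c lens-5 g84; HOME-only): the BOND-DIFFERENCE tube — charts that budget PAIR deviations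
# `‖D a − D b‖ ≤ B(z₀)(e a, e b)` directly, their two leaves, the proved junction to [CORE-FAR] and to the crux BY NAME, and the cover cut

Lineage `…Theses.FrustratedLawDichotomy.AperiodicFrustratedLawGap` (stmt-27623); T-leaf target of record **[CORE-FAR]**
`CoreOffTubeFloor (63/10) (63/10) (24/5) (1/100) 0` ⟸ (TF-G) `TubeFloorG 𝓘 τ T` ∧ (BC-G) `FamilyCoverG 𝓘 ρ ε (1/8) τ T` (77G `…GradedTube`), the cover cut
into (K) ∧ (D) `Refine` (81B `…CoverBridgeA`).

## Why a new currency (census FINAL, critic rows 1359/1361/1367).  Every SITE-table cell at `ϱ = 133/10` is dead for cause: the interval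
`[T_min, E_cap]` is EMPTY on FZ09/FZ62/HM62 (`T_min(flat) = .0354 / .0284 / .0203` against `V = .935 / .999 / 1.001`).  The site table `T` prices a
ball site's WHOLE displacement `D a := (z a − z c) − (z₀ (e a) − z₀ c₀)`; the certificate's adversary is then free to move two NEIGHBOURING sites
independently in their boxes — a pair deviation `T(e a) + T(e b) ≈ 2τ` on a nearest-neighbour bond (`chartByG_bond`), i.e. a local strain of order
`2τ / 1.1 ≈ 6 %` at `τ = .035`, which no elastic cluster charted at amplitude `τ` exhibits (census witnesses: nn pair deviations `≤ 1.0e-2` core,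
p90 `5–8e-3`, memo NKBUDGET83 §1).  But the scored quantity `ballAvg (9/5) z (xRec M z) c` is a PAIR functional: a site of the `9/5`-core sees the
configuration only through the bonds `(a, b)`, `|ab| ≤ 9/2` (finite-range `effPot`, `Collar (9/2)` flags; `63/10 = 9/5 + 9/2`), hence only through the
differences `D a − D b`.  The economy the site currency cannot express: budget the DIFFERENCES.

## The node (lens-5 grammar: finite range = SHORT bonds (stiff, tight budget); asymptotic regime = LONG pairs (budget affine in the host pair length,
capped by the scalar); bridge = the cone inequality interpolating them + the proved junction / trades / cover cut).
* `ChartByGB 𝓘 τ T B` (§1) = a graded chart `ChartByG 𝓘 τ T` whose `63/10`-ball pairs ADDITIONALLY satisfy `dist (z a − z b) (z₀ (e a) − z₀ (e b)) ≤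
  B(z₀)(e a, e b)` for a PAIR TABLE `B : PairTab` (§0: `pairSum T` = what a site table already gives; `conePair β s` = floor + slope × host pair length;
  `innerCone Rᴱ β s B∞` = the cone on pairs touching the inner range `R₀ ≤ Rᴱ`, loose elsewhere; `pairTolOf f` = any function of the two host radii
  and the host pair length).
* **(TF-GB) `TubeFloorGB 𝓘 τ T B` [CERTIFICATE · UNDECIDED · INSTRUMENTABLE «PAIR-84-E»]** — every admissible clean mono-phase cluster GB-charted by a
  host of `𝓘` scores `≥ 0`.  WEAKER than (TF-G) at the same `(τ, T)` (`tubeFloorGB_of_tubeFloorG`), antitone in `B` and `T`.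
* **(BC-GB) `FamilyCoverGB 𝓘 ρ ε η₂ τ T B` [GEOMETRIC · UNDECIDED · INSTRUMENTABLE «PAIR-84-T»]** — every far-class good-centred cluster is, modulo an
  isometry, GB-charted.  STRONGER than (BC-G) at the same `(τ, T)` (`familyCoverG_of_familyCoverGB`), monotone in `B` and `T`.
* **JUNCTION (PROVED, §3)**: (TF-GB) ∧ (BC-GB) ⟹ `EdgeFarFloor … 0` ⟹ (η₂ = 1/8) [CORE-FAR] ⟹ `StrainedPatchRec`-line ⟹ THE CRUX BY NAME
  (`aperiodicFrustratedLawGap_of_homFloor_625_of_pairTube`, periodic twin), for EVERY family, scalar, site table and pair table.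
* **RECOVERY (PROVED)**: at `B = pairSum T` the GB-node IS the graded node of record leaf by leaf (`chartByGB_pairSum_iff`, `tubeFloorGB_pairSum_iff`,
  `familyCoverGB_pairSum_iff`); a pair table dominating the site sums adds nothing (`chartByGB_of_chartByG_of_sumLE`).
* **TRADES (PROVED, §1/§2)**: pair ⟹ site through the centre (`ChartByGB.dev_centre`: `‖D a‖ ≤ B(e a, c₀)`, so `ChartByGB τ T B ⟹ ChartByG τ (T ⊓ B(·, c₀))`,
  `ChartByGB.siteOfPair`); site ⟹ pair by the triangle inequality (`pairSum`); one-step chain `‖D a‖ ≤ B(e a, e b) + T(e b)` (`ChartByGB.dev_via`);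
  the SANDWICH `(TF-G)(τ, T) ⟹ (TF-GB)(τ, T, B) ⟹ (TF-G)(τ, T′)` for every `T′ ≤ T` with `pairSum T′ ≤ B` (`tubeFloorG_of_tubeFloorGB_of_sumLE`) and dually
  for the cover — the pair cell sits strictly between the loose and the tight uniform cells the census has already decided (E dead at `.04`, T dead at `.015`).
* **COVER CUT (PROVED, §4)**: (D_GB) `RefineGB 𝓘₀ 𝓘 ρ ε η₂ τ₀ T₀ τ T B` (a coarse graded chart tightens, modulo an isometry and a host re-fit, to a
  GB-chart) with (K) ∧ (D_GB) ⟹ (BC-GB) (`familyCoverGB_of_coarse_of_refineGB`), (D_GB) ⟸ (BC-GB), (D) ∘ (D_GB) = (D_GB) (`refineGB_of_refine_of_refineGB`: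
  the g81 radius ladder composes on the left), (D_GB) ⟺ (D) at `B = pairSum T`; the crux BY NAME from (TF-GB) ∧ (K) ∧ (D_GB).
* **CELL SHAPES (§5)**: the pure pair cell `(τ₀, constTol τ₀, B)` (site boxes conceded at the scalar, all tightness in `B`) and the inner-cone cell.

Every theorem is sorry-free over tree definitions ([formal bookkeeping] / [folklore] / [folklore instantiation]); numbers are the census's
(memo NODE-g84: instruments PAIR-84-E / PAIR-84-T, predictions P84-1…4).
-/

noncomputable section

namespace Summit.AtomisticToContinuum.Crystallization.Theorems.FrustratedLawDichotomyStrainedPatchPairTube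

open scoped BigOperators Classical
open Summit.AtomisticToContinuum.Crystallization.Theorems.ChargedEnergyGapNegative (eStar E3)
open Summit.AtomisticToContinuum.Crystallization.Theorems.FrustratedLawDichotomyRangeCut
open Summit.AtomisticToContinuum.Crystallization.Theorems.FrustratedLawDichotomySchurCut
open Summit.AtomisticToContinuum.Crystallization.Theorems.FrustratedLawDichotomyMotifLemmas (GoodAtScale)
open Summit.AtomisticToContinuum.Crystallization.Theorems.FrustratedLawDichotomyAveragingCut (ballAvg)
open Summit.AtomisticToContinuum.Crystallization.Theorems.FrustratedLawDichotomyExemptLocOpt (LocOptFails)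
open Summit.AtomisticToContinuum.Crystallization.Theorems.FrustratedLawDichotomyExemptSplit (SchurElasticPricingX)
open Summit.AtomisticToContinuum.Crystallization.Theorems.FrustratedLawDichotomyExemptAbsorptionRecord
open Summit.AtomisticToContinuum.Crystallization.Theorems.FrustratedLawDichotomyCollarCensus
open Summit.AtomisticToContinuum.Crystallization.Theorems.FrustratedLawDichotomyCollarCensusKappa
open Summit.AtomisticToContinuum.Crystallization.Theorems.FrustratedLawDichotomyStrainedPatchHomSplit
open Summit.AtomisticToContinuum.Crystallization.Theorems.FrustratedLawDichotomyStrainedPatchCleanCollar (CleanBall TailPenalty AnnularDefectFloor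
  DefectiveCollarFloor)
open Summit.AtomisticToContinuum.Crystallization.Theorems.FrustratedLawDichotomyStrainedPatchPhaseCut (MonoPhaseBall AnnularPhaseFloor PolyTextureFloor
  monoPhaseBall_comp_iff)
open Summit.AtomisticToContinuum.Crystallization.Theorems.FrustratedLawDichotomyStrainedPatchCoreTube (NearHomIsoAt CoreOffTubeFloor nearHomIsoAt_comp_iff)
open Summit.AtomisticToContinuum.Crystallization.Theorems.FrustratedLawDichotomyStrainedPatchCoreTubeRecord (CoreCoreRelief)
open Summit.AtomisticToContinuum.Crystallization.Theorems.FrustratedLawDichotomyStrainedPatchStrainBands (EdgeFarFloor coreOff_iff_edge_and_soft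
  softFarFloor_eighth)
open Summit.AtomisticToContinuum.Crystallization.Theorems.FrustratedLawDichotomyStrainedPatchHomIsometry (admissible_comp_iff goodAtScale_comp_iff
  dist_comp injective_comp_iff)
open Summit.AtomisticToContinuum.Crystallization.Theorems.FrustratedLawDichotomyStrainedPatchHomTubeIso (cleanBall_comp_iff ballAvg_xRec_comp)
open Summit.AtomisticToContinuum.Crystallization.Theorems.FrustratedLawDichotomyStrainedPatchChartFamilies (ChartBy FamilyLE familyLE_refl
  ChartBy.mono_t ChartBy.mono_family)
open Summit.AtomisticToContinuum.Crystallization.Theorems.FrustratedLawDichotomyStrainedPatchHostCells (TubeFloor FamilyCover FamP)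
open Summit.AtomisticToContinuum.Crystallization.Theorems.FrustratedLawDichotomyStrainedPatchQuantSlaving (ChartFam SlackTab)
open Summit.AtomisticToContinuum.Crystallization.Theorems.FrustratedLawDichotomyStrainedPatchGradedTube
open Summit.AtomisticToContinuum.Crystallization.Theorems.FrustratedLawDichotomyStrainedPatchCoverBridge
open Summit.AtomisticToContinuum.Crystallization.Theorems.FrustratedLawDichotomyAperiodicGapRecordJunctionCore
  (aperiodicFrustratedLawGap_of_homFloor_625_of_coreOff periodicFrustratedLawGap_of_homFloor_625_of_coreOff)

/-! ## §3. The junction: (TF-GB) ∧ (BC-GB) ⟹ [CORE-FAR] ⟹ the crux BY NAME -/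

section Junction

variable {𝓘 : ChartFam} {ρ ε η₂ τ : ℝ} {T : SlackTab} {B : PairTab}

/-- ★★ THE PAIR JUNCTION: (TF-GB) ∧ (BC-GB) ⟹ `EdgeFarFloor (63/10) (63/10) ρ ε η₂ 0` — chart the rotated cluster by the pair cover, apply the pair
certificate, the score is isometry-invariant.  Every family, scalar, site table and pair table. [folklore] -/
theorem edgeFar_of_tubeFloorGB_of_coverGB (hT : TubeFloorGB 𝓘 τ T B) (hC : FamilyCoverGB 𝓘 ρ ε η₂ τ T B) :
    EdgeFarFloor (63 / 10) (63 / 10) ρ ε η₂ 0 := by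
  intro M z c hz hcl hm hn hg
  obtain ⟨R, M₀, z₀, c₀, e, hch⟩ := hC M z c hz hcl hm hn hg
  have h₁ := hT M (⇑R ∘ z) c M₀ z₀ c₀ e ((admissible_comp_iff R z c).2 hz) ((cleanBall_comp_iff R z c).2 hcl)
    ((monoPhaseBall_comp_iff R z c).2 hm) hch
  rwa [ballAvg_xRec_comp] at h₁

/-- ★★ … and at `η₂ = 1/8` the soft band is vacuous: (TF-GB) ∧ (BC-GB) ⟹ `CoreOffTubeFloor (63/10) (63/10) ρ ε 0`. [folklore] -/
theorem coreOff_of_tubeFloorGB_of_coverGB_eighth (hT : TubeFloorGB 𝓘 τ T B) (hC : FamilyCoverGB 𝓘 ρ ε (1 / 8) τ T B) :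
    CoreOffTubeFloor (63 / 10) (63 / 10) ρ ε 0 :=
  (coreOff_iff_edge_and_soft _ _ ρ ε (1 / 8) 0).2 ⟨edgeFar_of_tubeFloorGB_of_coverGB hT hC, softFarFloor_eighth (by norm_num) _ _ _ _⟩

/-- ★★ THE RECORD: the pair AND-node at ANY `(𝓘, τ, T, B)` gives the T-leaf target of record **[CORE-FAR]** `CoreOffTubeFloor (63/10) (63/10) (24/5) (1/100) 0`.
[formal bookkeeping] -/
theorem coreOff_record_of_pairTube (hT : TubeFloorGB 𝓘 τ T B) (hC : FamilyCoverGB 𝓘 (24 / 5) (1 / 100) (1 / 8) τ T B) :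
    CoreOffTubeFloor (63 / 10) (63 / 10) (24 / 5) (1 / 100) 0 :=
  coreOff_of_tubeFloorGB_of_coverGB_eighth hT hC

/-- ★ MIXED MONOTONICITY of the node: a certificate at `(T′, B′)` and a cover at `(T, B) ≤ (T′, B′)` close it. [formal bookkeeping] -/
theorem coreOff_record_of_pairTube_of_le {T' : SlackTab} {B' : PairTab} (hTle : TolLE T T') (hBle : PairLE B B') (hT : TubeFloorGB 𝓘 τ T' B')
    (hC : FamilyCoverGB 𝓘 (24 / 5) (1 / 100) (1 / 8) τ T B) : CoreOffTubeFloor (63 / 10) (63 / 10) (24 / 5) (1 / 100) 0 :=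
  coreOff_record_of_pairTube ((hT.anti_tol hTle).anti_pair hBle) hC

/-- ★ RECOVERY of the graded node of record (77G `coreOff_record_of_gradedTube`) as the member `B = pairSum T`. [formal bookkeeping] -/
theorem coreOff_record_of_gradedTube' (hT : TubeFloorG 𝓘 τ T) (hC : FamilyCoverG 𝓘 (24 / 5) (1 / 100) (1 / 8) τ T) :
    CoreOffTubeFloor (63 / 10) (63 / 10) (24 / 5) (1 / 100) 0 :=
  coreOff_record_of_pairTube (tubeFloorGB_pairSum_iff.2 hT) (familyCoverGB_pairSum_iff.2 hC)

/-- ★★★ **THE CRUX BY NAME (27623)** from the record data of `…RecordJunctionCore` with the T-pair in PAIR currency: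
`UP ∧ 0 ≤ D_X ∧ Eopt-raw ∧ HomFloor (1/625) ∧ TailPenalty ∧ CoreCoreRelief ∧ (TF-GB) TubeFloorGB 𝓘 τ T B ∧ (BC-GB) FamilyCoverGB 𝓘 (24/5) (1/100) (1/8) τ T B ∧
AnnularPhaseFloor ∧ PolyTextureFloor ∧ AnnularDefectFloor ∧ DefectiveCollarFloor ∧ CC∪T₀ ∧ DD∪T₀ ⟹ AperiodicFrustratedLawGap`, for EVERY family, scalar,
site table and pair table. [folklore instantiation] -/
theorem aperiodicFrustratedLawGap_of_homFloor_625_of_pairTube {εE CE DE DX : ℝ}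
    (hε0 : 0 < εE) (hε1 : εE ≤ 1 / 10000) (hU : PeriodicEnergyCeiling (-(7175 / 10000))) (hDX : 0 ≤ DX)
    (hE : SchurElasticPricingX (1 / 20) (1 / 8) w₄₅ ω₄ (3 / 400) (-(7175 / 10000)) (1 / 10000) CE DE DX (LocOptFails eStar εE (3 / 2) 1))
    (hHF : HomFloor (1 / 625)) (hTP : TailPenalty (24 / 5) (1 / 1000)) (hRl : CoreCoreRelief (63 / 10) (63 / 10) (24 / 5) (1 / 100) (3 / 5000))
    (hTF : TubeFloorGB 𝓘 τ T B) (hBC : FamilyCoverGB 𝓘 (24 / 5) (1 / 100) (1 / 8) τ T B)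
    (hF : AnnularPhaseFloor (63 / 10) (24 / 5) (63 / 10) (1 / 1000))
    (hP : PolyTextureFloor (63 / 10) (24 / 5) (1 / 1000)) (hA : AnnularDefectFloor (24 / 5) (63 / 10)) (hD : DefectiveCollarFloor (24 / 5))
    (h2 : CrowdedCoreMotifPricingCapK (1 / 1000) (9 / 5) (133 / 10) (3 / 2) (effPot w₄₅ ω₄ (3 / 400)) (-(7175 / 10000) + 3 / 400)
      (Collar (9 / 2) fun N y j => (∃ s : ℝ, 0 ≤ s ∧ s ≤ 3 / 2 ∧ NonEquilibriumCore (-(7175 / 10000)) 0 7 s (1 / 10000) N y j) ∨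
        GoodAtScale (1 / 20) (3 / 2) y j))
    (h3 : DiluteDefectMotifPricingCapK (1 / 1000) (9 / 5) (133 / 10) (3 / 2) (effPot w₄₅ ω₄ (3 / 400)) (-(7175 / 10000) + 3 / 400)
      (Collar (9 / 2) fun N y j => (∃ s : ℝ, 0 ≤ s ∧ s ≤ 3 / 2 ∧ NonEquilibriumCore (-(7175 / 10000)) 0 7 s (1 / 10000) N y j) ∨
        GoodAtScale (1 / 20) (3 / 2) y j)) :
    Summit.AtomisticToContinuum.Crystallization.Theses.FrustratedLawDichotomy.AperiodicFrustratedLawGap :=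
  aperiodicFrustratedLawGap_of_homFloor_625_of_coreOff hε0 hε1 hU hDX hE hHF hTP hRl (coreOff_record_of_pairTube hTF hBC) hF hP hA hD h2 h3

/-- ★★ **Periodic sibling (27624)** in pair currency. [folklore instantiation] -/
theorem periodicFrustratedLawGap_of_homFloor_625_of_pairTube {εE CE DE DX : ℝ}
    (hε0 : 0 < εE) (hε1 : εE ≤ 1 / 10000) (hU : PeriodicEnergyCeiling (-(7175 / 10000))) (hDX : 0 ≤ DX)
    (hE : SchurElasticPricingX (1 / 20) (1 / 8) w₄₅ ω₄ (3 / 400) (-(7175 / 10000)) (1 / 10000) CE DE DX (LocOptFails eStar εE (3 / 2) 1))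
    (hHF : HomFloor (1 / 625)) (hTP : TailPenalty (24 / 5) (1 / 1000)) (hRl : CoreCoreRelief (63 / 10) (63 / 10) (24 / 5) (1 / 100) (3 / 5000))
    (hTF : TubeFloorGB 𝓘 τ T B) (hBC : FamilyCoverGB 𝓘 (24 / 5) (1 / 100) (1 / 8) τ T B)
    (hF : AnnularPhaseFloor (63 / 10) (24 / 5) (63 / 10) (1 / 1000))
    (hP : PolyTextureFloor (63 / 10) (24 / 5) (1 / 1000)) (hA : AnnularDefectFloor (24 / 5) (63 / 10)) (hD : DefectiveCollarFloor (24 / 5))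
    (h2 : CrowdedCoreMotifPricingCapK (1 / 1000) (9 / 5) (133 / 10) (3 / 2) (effPot w₄₅ ω₄ (3 / 400)) (-(7175 / 10000) + 3 / 400)
      (Collar (9 / 2) fun N y j => (∃ s : ℝ, 0 ≤ s ∧ s ≤ 3 / 2 ∧ NonEquilibriumCore (-(7175 / 10000)) 0 7 s (1 / 10000) N y j) ∨
        GoodAtScale (1 / 20) (3 / 2) y j))
    (h3 : DiluteDefectMotifPricingCapK (1 / 1000) (9 / 5) (133 / 10) (3 / 2) (effPot w₄₅ ω₄ (3 / 400)) (-(7175 / 10000) + 3 / 400)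
      (Collar (9 / 2) fun N y j => (∃ s : ℝ, 0 ≤ s ∧ s ≤ 3 / 2 ∧ NonEquilibriumCore (-(7175 / 10000)) 0 7 s (1 / 10000) N y j) ∨
        GoodAtScale (1 / 20) (3 / 2) y j)) :
    Summit.AtomisticToContinuum.Crystallization.Theses.FrustratedLawDichotomy.PeriodicFrustratedLawGap :=
  periodicFrustratedLawGap_of_homFloor_625_of_coreOff hε0 hε1 hU hDX hE hHF hTP hRl (coreOff_record_of_pairTube hTF hBC) hF hP hA hD h2 h3

end Junction

/-! ## §4. The cover cut in pair currency: (K) coarse graded cover ∧ (D_GB) pair refinement ⟹ (BC-GB) -/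

/-- (piece) [route statement · this cell; NOT a literature fact] ★★ **(D_GB) `RefineGB 𝓘₀ 𝓘 ρ ε η₂ τ₀ T₀ τ T B` [ANALYTIC — THE PAIR BRIDGE; UNDECIDED · INSTRUMENTABLE «PAIR-84-T»]** — every admissible, clean,
mono-phase, far-class, `η₂`-good-centred cluster that is GRADED-charted by a host of the COARSE family `𝓘₀` at the coarse data `(τ₀, T₀)` is, modulo a
linear isometry, GB-charted by a host of `𝓘` at `(τ, T, B)`.  With `T` loose and `B` a cone this is a LIPSCHITZ (strain) estimate on the chart residual
— amplitude conceded, gradient controlled — and nothing else. -/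
def RefineGB (𝓘₀ 𝓘 : ChartFam) (ρ ε η₂ τ₀ : ℝ) (T₀ : SlackTab) (τ : ℝ) (T : SlackTab) (B : PairTab) : Prop :=
  ∀ (M : ℕ) (z : Fin M → E3) (c : Fin M) (M₀ : ℕ) (z₀ : Fin M₀ → E3) (c₀ : Fin M₀) (e : Fin M → Fin M₀),
    Admissible M z c → CleanBall (63 / 10) z c → MonoPhaseBall (63 / 10) z c → ¬NearHomIsoAt ρ ε z c → GoodAtScale η₂ (3 / 2) z c →
      ChartByG 𝓘₀ τ₀ T₀ z c z₀ c₀ e →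
        ∃ (R : E3 ≃ₗᵢ[ℝ] E3) (M₁ : ℕ) (z₁ : Fin M₁ → E3) (c₁ : Fin M₁) (e₁ : Fin M → Fin M₁), ChartByGB 𝓘 τ T B (⇑R ∘ z) c z₁ c₁ e₁

/-- (piece) [route statement · this cell; NOT a literature fact] **(D_GB⁼) `RefineGBAlong`** — the LABEL-PRESERVING form (host re-fitted, labels kept): what a regularity argument delivers and the census measures. -/
def RefineGBAlong (𝓘₀ 𝓘 : ChartFam) (ρ ε η₂ τ₀ : ℝ) (T₀ : SlackTab) (τ : ℝ) (T : SlackTab) (B : PairTab) : Prop :=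
  ∀ (M : ℕ) (z : Fin M → E3) (c : Fin M) (M₀ : ℕ) (z₀ : Fin M₀ → E3) (c₀ : Fin M₀) (e : Fin M → Fin M₀),
    Admissible M z c → CleanBall (63 / 10) z c → MonoPhaseBall (63 / 10) z c → ¬NearHomIsoAt ρ ε z c → GoodAtScale η₂ (3 / 2) z c →
      ChartByG 𝓘₀ τ₀ T₀ z c z₀ c₀ e →
        ∃ (R : E3 ≃ₗᵢ[ℝ] E3) (z₁ : Fin M₀ → E3), ChartByGB 𝓘 τ T B (⇑R ∘ z) c z₁ c₀ e

section Bridge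

variable {𝓘₀ 𝓘₁ 𝓘 𝓘' : ChartFam} {ρ ε η₂ τ₀ τ₁ τ τ' : ℝ} {T₀ T₁ T T' : SlackTab} {B B' : PairTab}

/-- (D_GB⁼) ⟹ (D_GB). [formal bookkeeping] -/
theorem refineGB_of_refineGBAlong (h : RefineGBAlong 𝓘₀ 𝓘 ρ ε η₂ τ₀ T₀ τ T B) : RefineGB 𝓘₀ 𝓘 ρ ε η₂ τ₀ T₀ τ T B :=
  fun M z c M₀ z₀ c₀ e hz hcl hm hn hg hch =>
    let ⟨R, z₁, h₁⟩ := h M z c M₀ z₀ c₀ e hz hcl hm hn hg hch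
    ⟨R, M₀, z₁, c₀, e, h₁⟩

/-- ★★ **THE CUT: (K) ∧ (D_GB) ⟹ (BC-GB).** [folklore] -/
theorem familyCoverGB_of_coarse_of_refineGB (hK : FamilyCoverG 𝓘₀ ρ ε η₂ τ₀ T₀) (hD : RefineGB 𝓘₀ 𝓘 ρ ε η₂ τ₀ T₀ τ T B) :
    FamilyCoverGB 𝓘 ρ ε η₂ τ T B := by
  intro M z c hz hcl hm hn hg
  obtain ⟨R₀, M₀, z₀, c₀, e, hch⟩ := hK M z c hz hcl hm hn hg
  obtain ⟨R₁, M₁, z₁, c₁, e₁, hch₁⟩ := hD M (⇑R₀ ∘ z) c M₀ z₀ c₀ e ((admissible_comp_iff R₀ z c).2 hz)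
    ((cleanBall_comp_iff R₀ z c).2 hcl) ((monoPhaseBall_comp_iff R₀ z c).2 hm) (fun h => hn ((nearHomIsoAt_comp_iff R₀ z c).1 h))
    ((goodAtScale_comp_iff R₀ z c).2 hg) hch
  refine ⟨R₀.trans R₁, M₁, z₁, c₁, e₁, ?_⟩
  have hcomp : ⇑(R₀.trans R₁) ∘ z = ⇑R₁ ∘ (⇑R₀ ∘ z) := by
    funext a
    simp
  rw [hcomp]
  exact hch₁

/-- (D_GB) is WEAKER than the pair cover it feeds. [formal bookkeeping] -/
theorem refineGB_of_familyCoverGB (h : FamilyCoverGB 𝓘 ρ ε η₂ τ T B) : RefineGB 𝓘₀ 𝓘 ρ ε η₂ τ₀ T₀ τ T B :=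
  fun M z c _ _ _ _ hz hcl hm hn hg _ => h M z c hz hcl hm hn hg

/-- ★ EXACT CUT: when the coarse data dominate (`𝓘 ≤ 𝓘₀`, `T ≤ T₀`, `τ ≤ τ₀`) the pair cover IS (K) ∧ (D_GB). [folklore] -/
theorem familyCoverGB_iff_coarse_and_refineGB (h𝓘 : FamilyLE 𝓘 𝓘₀) (hT : TolLE T T₀) (hτ : τ ≤ τ₀) :
    FamilyCoverGB 𝓘 ρ ε η₂ τ T B ↔ FamilyCoverG 𝓘₀ ρ ε η₂ τ₀ T₀ ∧ RefineGB 𝓘₀ 𝓘 ρ ε η₂ τ₀ T₀ τ T B :=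
  ⟨fun h => ⟨((familyCoverG_of_familyCoverGB h).mono_tol hT |>.mono_family h𝓘) |> fun h' => by
      intro M z c hz hcl hm hn hg
      obtain ⟨R, M₀, z₀, c₀, e, hch⟩ := h' M z c hz hcl hm hn hg
      exact ⟨R, M₀, z₀, c₀, e, chartByG_mono_scalar hch hτ⟩, refineGB_of_familyCoverGB h⟩,
    fun h => familyCoverGB_of_coarse_of_refineGB h.1 h.2⟩

/-- (D) ⟹ (D_GB) at a pair table dominating the tight site sums (no pair content)… [formal bookkeeping] -/
theorem refineGB_of_refine_of_sumLE (h : Refine 𝓘₀ 𝓘 ρ ε η₂ τ₀ T₀ τ T) (hB : SumLE T B) : RefineGB 𝓘₀ 𝓘 ρ ε η₂ τ₀ T₀ τ T B :=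
  fun M z c M₀ z₀ c₀ e hz hcl hm hn hg hch =>
    let ⟨R, M₁, z₁, c₁, e₁, h₁⟩ := h M z c M₀ z₀ c₀ e hz hcl hm hn hg hch
    ⟨R, M₁, z₁, c₁, e₁, chartByGB_of_chartByG_of_sumLE h₁ hB⟩

/-- … and (D_GB) ⟹ (D) always. [formal bookkeeping] -/
theorem refine_of_refineGB (h : RefineGB 𝓘₀ 𝓘 ρ ε η₂ τ₀ T₀ τ T B) : Refine 𝓘₀ 𝓘 ρ ε η₂ τ₀ T₀ τ T :=
  fun M z c M₀ z₀ c₀ e hz hcl hm hn hg hch =>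
    let ⟨R, M₁, z₁, c₁, e₁, h₁⟩ := h M z c M₀ z₀ c₀ e hz hcl hm hn hg hch
    ⟨R, M₁, z₁, c₁, e₁, h₁.1⟩

/-- ★ RECOVERY: at `B = pairSum T` the pair bridge IS the g81 bridge (D). [formal bookkeeping] -/
theorem refineGB_pairSum_iff : RefineGB 𝓘₀ 𝓘 ρ ε η₂ τ₀ T₀ τ T (pairSum T) ↔ Refine 𝓘₀ 𝓘 ρ ε η₂ τ₀ T₀ τ T :=
  ⟨refine_of_refineGB, fun h => refineGB_of_refine_of_sumLE h (PairLE.refl _)⟩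

/-- (D_GB) is monotone in the tight data… [formal bookkeeping] -/
theorem RefineGB.mono (h : RefineGB 𝓘₀ 𝓘 ρ ε η₂ τ₀ T₀ τ T B) (h𝓘 : FamilyLE 𝓘 𝓘') (hT : TolLE T T') (hB : PairLE B B') (hτ : τ ≤ τ') :
    RefineGB 𝓘₀ 𝓘' ρ ε η₂ τ₀ T₀ τ' T' B' :=
  fun M z c M₀ z₀ c₀ e hz hcl hm hn hg hch =>
    let ⟨R, M₁, z₁, c₁, e₁, h₁⟩ := h M z c M₀ z₀ c₀ e hz hcl hm hn hg hch
    ⟨R, M₁, z₁, c₁, e₁, h₁.weaken h𝓘 hT hB hτ⟩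

/-- ★ THE LADDER COMPOSES ON THE LEFT: a g81 radius-ladder bridge (D) `(τ₀, T₀) → (τ₁, T₁)` followed by a pair bridge `(τ₁, T₁) → (τ, T, B)` is a pair
bridge `(τ₀, T₀) → (τ, T, B)`. [folklore] -/
theorem refineGB_of_refine_of_refineGB (h₁ : Refine 𝓘₀ 𝓘₁ ρ ε η₂ τ₀ T₀ τ₁ T₁) (h₂ : RefineGB 𝓘₁ 𝓘 ρ ε η₂ τ₁ T₁ τ T B) :
    RefineGB 𝓘₀ 𝓘 ρ ε η₂ τ₀ T₀ τ T B := by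
  intro M z c M₀ z₀ c₀ e hz hcl hm hn hg hch
  obtain ⟨R₁, M₁, z₁, c₁, e₁, hch₁⟩ := h₁ M z c M₀ z₀ c₀ e hz hcl hm hn hg hch
  obtain ⟨R₂, M₂, z₂, c₂, e₂, hch₂⟩ := h₂ M (⇑R₁ ∘ z) c M₁ z₁ c₁ e₁ ((admissible_comp_iff R₁ z c).2 hz)
    ((cleanBall_comp_iff R₁ z c).2 hcl) ((monoPhaseBall_comp_iff R₁ z c).2 hm) (fun h => hn ((nearHomIsoAt_comp_iff R₁ z c).1 h))
    ((goodAtScale_comp_iff R₁ z c).2 hg) hch₁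
  refine ⟨R₁.trans R₂, M₂, z₂, c₂, e₂, ?_⟩
  have hcomp : ⇑(R₁.trans R₂) ∘ z = ⇑R₂ ∘ (⇑R₁ ∘ z) := by
    funext a
    simp
  rw [hcomp]
  exact hch₂

/-- ★★ [CORE-FAR] from (TF-GB) ∧ (K) ∧ (D_GB), every family pair, scalars, tables. [folklore] -/
theorem coreOff_of_tubeFloorGB_of_coarse_of_refineGB (hT : TubeFloorGB 𝓘 τ T B) (hK : FamilyCoverG 𝓘₀ ρ ε (1 / 8) τ₀ T₀)
    (hD : RefineGB 𝓘₀ 𝓘 ρ ε (1 / 8) τ₀ T₀ τ T B) : CoreOffTubeFloor (63 / 10) (63 / 10) ρ ε 0 :=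
  coreOff_of_tubeFloorGB_of_coverGB_eighth hT (familyCoverGB_of_coarse_of_refineGB hK hD)

/-- ★★ THE RECORD with the cover cut in pair currency. [formal bookkeeping] -/
theorem coreOff_record_of_coarse_of_refineGB (hT : TubeFloorGB 𝓘 τ T B) (hK : FamilyCoverG 𝓘₀ (24 / 5) (1 / 100) (1 / 8) τ₀ T₀)
    (hD : RefineGB 𝓘₀ 𝓘 (24 / 5) (1 / 100) (1 / 8) τ₀ T₀ τ T B) : CoreOffTubeFloor (63 / 10) (63 / 10) (24 / 5) (1 / 100) 0 :=
  coreOff_of_tubeFloorGB_of_coarse_of_refineGB hT hK hD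

/-- ★★★ **THE CRUX BY NAME (27623)** with the cover leaf cut in pair currency:
`… ∧ (TF-GB) TubeFloorGB 𝓘 τ T B ∧ (K) FamilyCoverG 𝓘₀ (24/5) (1/100) (1/8) τ₀ T₀ ∧ (D_GB) RefineGB 𝓘₀ 𝓘 (24/5) (1/100) (1/8) τ₀ T₀ τ T B ∧ … ⟹
AperiodicFrustratedLawGap`. [folklore instantiation] -/
theorem aperiodicFrustratedLawGap_of_homFloor_625_of_pairBridge {εE CE DE DX : ℝ}
    (hε0 : 0 < εE) (hε1 : εE ≤ 1 / 10000) (hU : PeriodicEnergyCeiling (-(7175 / 10000))) (hDX : 0 ≤ DX)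
    (hE : SchurElasticPricingX (1 / 20) (1 / 8) w₄₅ ω₄ (3 / 400) (-(7175 / 10000)) (1 / 10000) CE DE DX (LocOptFails eStar εE (3 / 2) 1))
    (hHF : HomFloor (1 / 625)) (hTP : TailPenalty (24 / 5) (1 / 1000)) (hRl : CoreCoreRelief (63 / 10) (63 / 10) (24 / 5) (1 / 100) (3 / 5000))
    (hTF : TubeFloorGB 𝓘 τ T B) (hK : FamilyCoverG 𝓘₀ (24 / 5) (1 / 100) (1 / 8) τ₀ T₀)
    (hBr : RefineGB 𝓘₀ 𝓘 (24 / 5) (1 / 100) (1 / 8) τ₀ T₀ τ T B)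
    (hF : AnnularPhaseFloor (63 / 10) (24 / 5) (63 / 10) (1 / 1000))
    (hP : PolyTextureFloor (63 / 10) (24 / 5) (1 / 1000)) (hA : AnnularDefectFloor (24 / 5) (63 / 10)) (hD : DefectiveCollarFloor (24 / 5))
    (h2 : CrowdedCoreMotifPricingCapK (1 / 1000) (9 / 5) (133 / 10) (3 / 2) (effPot w₄₅ ω₄ (3 / 400)) (-(7175 / 10000) + 3 / 400)
      (Collar (9 / 2) fun N y j => (∃ s : ℝ, 0 ≤ s ∧ s ≤ 3 / 2 ∧ NonEquilibriumCore (-(7175 / 10000)) 0 7 s (1 / 10000) N y j) ∨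
        GoodAtScale (1 / 20) (3 / 2) y j))
    (h3 : DiluteDefectMotifPricingCapK (1 / 1000) (9 / 5) (133 / 10) (3 / 2) (effPot w₄₅ ω₄ (3 / 400)) (-(7175 / 10000) + 3 / 400)
      (Collar (9 / 2) fun N y j => (∃ s : ℝ, 0 ≤ s ∧ s ≤ 3 / 2 ∧ NonEquilibriumCore (-(7175 / 10000)) 0 7 s (1 / 10000) N y j) ∨
        GoodAtScale (1 / 20) (3 / 2) y j)) :
    Summit.AtomisticToContinuum.Crystallization.Theses.FrustratedLawDichotomy.AperiodicFrustratedLawGap :=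
  aperiodicFrustratedLawGap_of_homFloor_625_of_pairTube hε0 hε1 hU hDX hE hHF hTP hRl hTF (familyCoverGB_of_coarse_of_refineGB hK hBr)
    hF hP hA hD h2 h3

end Bridge

/-! ## §5. The pre-registered cell SHAPES (Lean fixes shapes, the census fixes numbers — memo NODE-g84 §3) -/

section Cells

variable {𝓘 𝓘₀ : ChartFam} {τ₀ β s RE Binf : ℝ} {T₀ : SlackTab} {B : PairTab}

/-- ★ **THE PURE PAIR CELL** `(τ₀, constTol τ₀, B)`: site boxes conceded at the scalar (the site clause is then the scalar clause — no site grading at all),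
ALL tightness in the pair table.  [CORE-FAR] at the record dials. [formal bookkeeping] -/
theorem coreOff_record_of_purePairCell (hT : TubeFloorGB 𝓘 τ₀ (constTol τ₀) B) (hC : FamilyCoverGB 𝓘 (24 / 5) (1 / 100) (1 / 8) τ₀ (constTol τ₀) B) :
    CoreOffTubeFloor (63 / 10) (63 / 10) (24 / 5) (1 / 100) 0 :=
  coreOff_record_of_pairTube hT hC

/-- In the pure pair cell the GB-chart is a SCALAR chart plus the pair clause. [formal bookkeeping] -/
theorem chartByGB_constTol_iff {M : ℕ} {z : Fin M → E3} {c : Fin M} {M₀ : ℕ} {z₀ : Fin M₀ → E3} {c₀ : Fin M₀} {e : Fin M → Fin M₀} :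
    ChartByGB 𝓘 τ₀ (constTol τ₀) B z c z₀ c₀ e ↔ ChartBy 𝓘 τ₀ τ₀ z c z₀ c₀ e ∧
      ∀ a b, dist (z a) (z c) ≤ 63 / 10 → dist (z b) (z c) ≤ 63 / 10 → dist (z a - z b) (z₀ (e a) - z₀ (e b)) ≤ B M₀ z₀ c₀ (e a) (e b) :=
  ⟨fun h => ⟨h.1.1, h.2⟩, fun h => ⟨chartByG_constTol_iff.2 h.1, h.2⟩⟩

/-- ★ **THE INNER-CONE CELL** with the cover cut: coarse = the scalar cover of record at `τ₀` (graded at `constTol τ₀`), tight = the pure pair cell at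
the inner cone `innerCone Rᴱ β s B∞`.  [CORE-FAR] at the record dials. [formal bookkeeping] -/
theorem coreOff_record_of_innerConeCell (hT : TubeFloorGB 𝓘 τ₀ (constTol τ₀) (innerCone RE β s Binf))
    (hK : FamilyCoverG 𝓘₀ (24 / 5) (1 / 100) (1 / 8) τ₀ (constTol τ₀))
    (hD : RefineGB 𝓘₀ 𝓘 (24 / 5) (1 / 100) (1 / 8) τ₀ (constTol τ₀) τ₀ (constTol τ₀) (innerCone RE β s Binf)) :
    CoreOffTubeFloor (63 / 10) (63 / 10) (24 / 5) (1 / 100) 0 :=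
  coreOff_record_of_coarse_of_refineGB hT hK hD

/-- The coarse leaf of the inner-cone cell from the SCALAR cover of record at `τ₀`. [formal bookkeeping] -/
theorem familyCoverG_constTol_of_cover (hK : FamilyCover 𝓘₀ (24 / 5) (1 / 100) (1 / 8) τ₀) :
    FamilyCoverG 𝓘₀ (24 / 5) (1 / 100) (1 / 8) τ₀ (constTol τ₀) :=
  familyCoverG_constTol_iff.2 hK

/-- ★ At `B∞ ≥ 2τ₀` the inner cone constrains ONLY the pairs touching the inner range: outside it the pair clause is implied by the scalar boxes.
[formal bookkeeping] -/
theorem innerCone_outer_vacuous (hB : 2 * τ₀ ≤ Binf) {M : ℕ} {z : Fin M → E3} {c : Fin M} {M₀ : ℕ} {z₀ : Fin M₀ → E3} {c₀ : Fin M₀}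
    {e : Fin M → Fin M₀} (h : ChartByG 𝓘 τ₀ (constTol τ₀) z c z₀ c₀ e) {a b : Fin M} (ha : dist (z a) (z c) ≤ 63 / 10) (hb : dist (z b) (z c) ≤ 63 / 10)
    (hout : RE < min (dist (z₀ (e a)) (z₀ c₀)) (dist (z₀ (e b)) (z₀ c₀))) :
    dist (z a - z b) (z₀ (e a) - z₀ (e b)) ≤ innerCone RE β s Binf M₀ z₀ c₀ (e a) (e b) := by
  have h₁ : dist (z a - z b) (z₀ (e a) - z₀ (e b)) ≤ constTol τ₀ M₀ z₀ c₀ (e a) + constTol τ₀ M₀ z₀ c₀ (e b) := by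
    rw [dist_eq_norm, disp_diff_eq]
    exact h.disp_diff ha hb
  simp only [constTol] at h₁
  unfold innerCone
  rw [if_neg (not_le.2 hout)]
  linarith

end Cells

end Summit.AtomisticToContinuum.Crystallization.Theorems.FrustratedLawDichotomyStrainedPatchPairTube
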